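import Mathlib.NumberTheory.NumberField.Discriminant.Different
import Mathlib.NumberTheory.RamificationInertia.Unramified
import Mathlib.RingTheory.DedekindDomain.Factorization
import Mathlib.RingTheory.Ideal.Norm.AbsNorm
import HarnessLib

/-!
# The `2`-division field of a curve supersingular at `2` is ramified at `2` (Eisenstein cubic)

Route `ResidualThetaTransportAtTwo`, crux K0⁺ `HeckeThetaPartnerAdicAtTwo` (stmt-BirchSwinnertonDyer-20690),
helper §R2 of the line "proof from print".  THEOREMS ONLY (no definition, no named fact, no `sorry`).

For a globally minimal `W/ℚ` with good supersingular reduction at `2` the monic integral `2`-division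
cubic is `h_W = X³ + 4βX² + 16γX + 16b₆` with `b₆` odd (`…CurveArith`), so `h_W(2X)/8` is Eisenstein at
`2` and `2` is (totally) ramified in the cubic field, hence in its `S₃`-closure `L = ℚ(W[2])`.  We prove
the consequence we need WITHOUT Newton polygons / Kummer–Dedekind, by an elementary descent:

* `dvd_of_dvd_pow_three_of_isUnramifiedIn` — if `2` is unramified in the number field `L`, then
  `2𝓞_L = ∏ 𝔔` is a product of distinct primes (`Ideal.map_algebraMap_eq_finsetProd_pow`, all
  `e = 1`), hence radical: `2 ∣ x³ ⟹ 2 ∣ x` in `𝓞_L`;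
* `not_isUnramifiedIn_two_of_root` — if moreover `θ ∈ 𝓞_L` is a root of `X³ + AX² + BX + 16c` with
  `4 ∣ A`, `16 ∣ B`, `c` odd, then `θ = 2θ₁`, `θ₁³ + 2aθ₁² + 4bθ₁ + 2c = 0`, `θ₁ = 2θ₂`,
  `c = -4(θ₂³ + aθ₂² + bθ₂)`, so `2 ∣ c` in `𝓞_L`, whence (norm to `ℤ`) `2 ∣ c` in `ℤ` — contradiction;
* `not_isUnramifiedIn_of_root` — the relative version over a subfield `k` in which `(2)` is prime:
  `L/k` is ramified at the prime `(2)` of `k` (unramifiedness composes in the tower `ℤ ⊆ 𝓞_k ⊆ 𝓞_L`,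
  `Algebra.IsUnramifiedAt.comp`, `2 ∤ d_k`).

References: H. Cohen, GTM 138, Cor. 6.2.4 (Eisenstein ⟹ totally ramified); J.-P. Serre, *Propriétés
galoisiennes…*, Invent. Math. 15 (1972) §5.4 (supersingular at `2`: `ℚ₂(E[2])` totally ramified of
degree `3` over the unramified quadratic); here only the elementary shadow is formalised.
-/

set_option autoImplicit false
set_option linter.dupNamespace false

noncomputable section

open scoped NumberField
open NumberField IsDedekindDomain

namespace Summit.BirchSwinnertonDyer.BirchSwinnertonDyer.Theorems.HeckeThetaPartner

/-! ### `2𝓞_L` is radical when `2` is unramified -/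

section OverInt

variable {L : Type*} [Field L] [NumberField L]

/-- An integer divisible by `2` in `𝓞_L` is even (norm down to `ℤ`). [folklore] -/
theorem two_dvd_of_two_dvd_intCast {c : ℤ} (h : (2 : 𝓞 L) ∣ (c : 𝓞 L)) : (2 : ℤ) ∣ c := by
  have hn := map_dvd (Algebra.norm ℤ) h
  rw [show (2 : 𝓞 L) = algebraMap ℤ (𝓞 L) 2 from by simp,
    show ((c : ℤ) : 𝓞 L) = algebraMap ℤ (𝓞 L) c from by simp,
    Algebra.norm_algebraMap, Algebra.norm_algebraMap] at hn
  have hd : Module.finrank ℤ (𝓞 L) ≠ 0 := by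
    rw [RingOfIntegers.rank]; exact Module.finrank_pos.ne'
  exact Int.prime_two.dvd_of_dvd_pow ((dvd_pow_self 2 hd).trans hn)

/-- **If `2` is unramified in `L` then `2𝓞_L` is radical: `2 ∣ x³ ⟹ 2 ∣ x`.**  `2𝓞_L = ∏_{𝔔 ∣ 2} 𝔔`
with distinct maximal `𝔔` (all ramification indices are `1`), a product of pairwise coprime ideals is
their intersection, and `x³ ∈ 𝔔 ⟹ x ∈ 𝔔`. [folklore] -/
theorem dvd_of_dvd_pow_three_of_isUnramifiedIn
    (hunr : Algebra.IsUnramifiedIn (𝓞 L) (Ideal.span {(2 : ℤ)})) {x : 𝓞 L}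
    (hx : (2 : 𝓞 L) ∣ x ^ 3) : (2 : 𝓞 L) ∣ x := by
  classical
  set p : Ideal ℤ := Ideal.span {(2 : ℤ)} with hpdef
  have hpprime : p.IsPrime := (Ideal.span_singleton_prime two_ne_zero).mpr Int.prime_two
  have hp0 : p ≠ ⊥ := by rw [hpdef, Ne, Ideal.span_singleton_eq_bot]; norm_num
  haveI hpmax : p.IsMaximal := hpprime.isMaximal hp0
  have hfac := Ideal.map_algebraMap_eq_finsetProd_pow (R := 𝓞 L) hp0
  have hmap : p.map (algebraMap ℤ (𝓞 L)) = Ideal.span {(2 : 𝓞 L)} := by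
    rw [hpdef, Ideal.map_span, Set.image_singleton, map_ofNat]
  have he1 : ∀ Q ∈ p.primesOver (𝓞 L), Q.ramificationIdx ℤ = 1 := by
    intro Q hQ
    haveI := hQ.1
    exact hunr.ramificationIdx_eq_one hQ.2
  -- `2𝓞_L = ∏ Q`
  have hprod : Ideal.span {(2 : 𝓞 L)} = ∏ Q ∈ (p.primesOver (𝓞 L)).toFinset, Q := by
    rw [← hmap, hfac]
    refine Finset.prod_congr rfl fun Q hQ => ?_
    rw [he1 Q (Set.mem_toFinset.mp hQ), pow_one]
  -- the primes over `2` are pairwise coprime maximal ideals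
  have hcop : ((p.primesOver (𝓞 L)).toFinset : Set (Ideal (𝓞 L))).Pairwise
      (Function.onFun IsCoprime fun Q : Ideal (𝓞 L) => Q) := by
    intro Q hQ Q' hQ' hne
    have hQm := Set.mem_toFinset.mp hQ
    have hQ'm := Set.mem_toFinset.mp hQ'
    haveI := hQm.1
    haveI := hQ'm.1
    haveI := hQm.2
    haveI := hQ'm.2
    haveI : Q.IsMaximal := Ideal.IsMaximal.of_liesOver_isMaximal Q p
    haveI : Q'.IsMaximal := Ideal.IsMaximal.of_liesOver_isMaximal Q' p
    exact Ideal.isCoprime_iff_sup_eq.mpr (Ideal.IsMaximal.coprime_of_ne inferInstance inferInstance hne)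
  -- `x ∈ Q` for every `Q ∣ 2`
  have hxQ : ∀ Q ∈ (p.primesOver (𝓞 L)).toFinset, x ∈ Q := by
    intro Q hQ
    have hQ' := Set.mem_toFinset.mp hQ
    haveI := hQ'.1
    have h3 : x ^ 3 ∈ Q := by
      have : x ^ 3 ∈ Ideal.span {(2 : 𝓞 L)} := Ideal.mem_span_singleton.mpr hx
      rw [hprod] at this
      exact (Ideal.prod_le_inf.trans (Finset.inf_le hQ)) this
    exact Ideal.IsPrime.mem_of_pow_mem inferInstance 3 h3
  -- hence `x ∈ ∏ Q = 2𝓞_L`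
  have hxprod : x ∈ ∏ Q ∈ (p.primesOver (𝓞 L)).toFinset, Q := by
    rw [Ideal.prod_eq_iInf_of_pairwise_isCoprime hcop]
    simp only [Ideal.mem_iInf]
    exact fun Q hQ => hxQ Q hQ
  rw [← hprod] at hxprod
  exact Ideal.mem_span_singleton.mp hxprod

/-- **Descent: a root of an Eisenstein-type cubic forbids `2` to be unramified.**  If `θ ∈ 𝓞_L`
satisfies `θ³ + Aθ² + Bθ + 16c = 0` with `4 ∣ A`, `16 ∣ B` and `c` odd, then `2` is ramified in `L`:
otherwise `2 ∣ θ³` gives `θ = 2θ₁` (`dvd_of_dvd_pow_three_of_isUnramifiedIn`), then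
`θ₁³ = -2(aθ₁² + 2bθ₁ + c)` gives `θ₁ = 2θ₂`, and `c = -4(θ₂³ + aθ₂² + bθ₂)` makes `c` even.
[cite: Cohen1993, §6.2.1 Cor. 6.2.4 (Eisenstein polynomials are totally ramified), p. 316] -/
theorem not_isUnramifiedIn_two_of_root (θ : 𝓞 L) {A B c : ℤ} (hA : 4 ∣ A) (hB : 16 ∣ B) (hc : Odd c)
    (hθ : θ ^ 3 + (A : 𝓞 L) * θ ^ 2 + (B : 𝓞 L) * θ + 16 * (c : 𝓞 L) = 0) :
    ¬ Algebra.IsUnramifiedIn (𝓞 L) (Ideal.span {(2 : ℤ)}) := by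
  intro hunr
  obtain ⟨a, rfl⟩ := hA
  obtain ⟨b, rfl⟩ := hB
  push_cast at hθ
  -- `θ = 2 θ₁`
  have h1 : (2 : 𝓞 L) ∣ θ ^ 3 :=
    ⟨-(2 * (a : 𝓞 L) * θ ^ 2 + 8 * (b : 𝓞 L) * θ + 8 * (c : 𝓞 L)), by linear_combination hθ⟩
  obtain ⟨θ₁, rfl⟩ := dvd_of_dvd_pow_three_of_isUnramifiedIn hunr h1
  have hθ₁ : θ₁ ^ 3 + 2 * (a : 𝓞 L) * θ₁ ^ 2 + 4 * (b : 𝓞 L) * θ₁ + 2 * (c : 𝓞 L) = 0 := by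
    have h8 : (8 : 𝓞 L) ≠ 0 := by norm_num
    apply mul_left_cancel₀ h8
    linear_combination hθ
  -- `θ₁ = 2 θ₂`
  have h2 : (2 : 𝓞 L) ∣ θ₁ ^ 3 :=
    ⟨-((a : 𝓞 L) * θ₁ ^ 2 + 2 * (b : 𝓞 L) * θ₁ + (c : 𝓞 L)), by linear_combination hθ₁⟩
  obtain ⟨θ₂, rfl⟩ := dvd_of_dvd_pow_three_of_isUnramifiedIn hunr h2
  -- `c` is even
  have h3 : (2 : 𝓞 L) ∣ (c : 𝓞 L) :=
    ⟨-(2 * θ₂ ^ 3 + 2 * (a : 𝓞 L) * θ₂ ^ 2 + 2 * (b : 𝓞 L) * θ₂), by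
      have h2' : (2 : 𝓞 L) ≠ 0 := by norm_num
      apply mul_left_cancel₀ h2'
      linear_combination hθ₁⟩
  exact (Int.not_even_iff_odd.mpr hc) (even_iff_two_dvd.mpr (two_dvd_of_two_dvd_intCast h3))

end OverInt

/-! ### The relative version over a subfield in which `(2)` is prime -/

section OverBase

variable {k : Type*} [Field k] [NumberField k] {L : Type*} [Field L] [NumberField L] [Algebra k L]

/-- **Unramified over `k` at `(2)` + `2 ∤ d_k` ⟹ unramified over `ℤ` at `2`.**  If `(2)` is a prime
`v` of `𝓞_k` (so the only prime above `2`), `2 ∤ d_k` (`2` unramified in `k`), and `v` is unramified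
in `L`, then `2` is unramified in `L` (composition of unramified extensions in the tower
`ℤ ⊆ 𝓞_k ⊆ 𝓞_L`). [folklore] -/
theorem isUnramifiedIn_int_two_of_isUnramifiedIn (v : HeightOneSpectrum (𝓞 k))
    (hv : v.asIdeal = Ideal.span {(2 : 𝓞 k)}) (hdk : ¬ (2 : ℤ) ∣ discr k)
    (hunr : Algebra.IsUnramifiedIn (𝓞 L) v.asIdeal) :
    Algebra.IsUnramifiedIn (𝓞 L) (Ideal.span {(2 : ℤ)}) := by
  classical
  have hunrk : Algebra.IsUnramifiedIn (𝓞 k) (Ideal.span {(2 : ℤ)}) :=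
    (NumberField.not_dvd_discr_iff_isUnramifiedIn k (𝓞 k) Int.prime_two).mp hdk
  set p : Ideal ℤ := Ideal.span {(2 : ℤ)} with hpdef
  have hpprime : p.IsPrime := (Ideal.span_singleton_prime two_ne_zero).mpr Int.prime_two
  have hp0 : p ≠ ⊥ := by rw [hpdef, Ne, Ideal.span_singleton_eq_bot]; norm_num
  haveI hpmax : p.IsMaximal := hpprime.isMaximal hp0
  haveI := v.isPrime
  -- `v` lies over `(2)`
  have h2v : ((2 : ℤ) : 𝓞 k) ∈ v.asIdeal := by
    rw [hv]; exact_mod_cast Ideal.mem_span_singleton_self (2 : 𝓞 k)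
  haveI hvp : v.asIdeal.LiesOver p := by
    refine ⟨hpmax.eq_of_le (Ideal.IsPrime.under ℤ v.asIdeal).ne_top fun x hx => ?_⟩
    rw [hpdef, Ideal.mem_span_singleton] at hx
    obtain ⟨c, rfl⟩ := hx
    rw [Ideal.mem_comap, map_mul, eq_intCast, eq_intCast]
    exact Ideal.mul_mem_right _ _ h2v
  haveI : Algebra.IsUnramifiedAt ℤ v.asIdeal :=
    (Algebra.isUnramifiedIn_iff_forall_of_isDedekindDomain.mp hunrk) v.asIdeal v.isMaximal hvp
  rw [Algebra.isUnramifiedIn_iff_forall_of_isDedekindDomain]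
  intro P hP hPp
  haveI := hP
  haveI := hPp
  -- `P ∩ 𝓞_k = v`
  haveI hPv : P.LiesOver v.asIdeal := by
    constructor
    haveI : (P.under (𝓞 k)).IsPrime := Ideal.IsPrime.under _ P
    have h2 : (2 : 𝓞 k) ∈ P.under (𝓞 k) := by
      rw [Ideal.mem_comap, map_ofNat]
      have h2Z : (2 : ℤ) ∈ P.under ℤ := by rw [← hPp.over]; exact Ideal.mem_span_singleton_self _
      rw [Ideal.mem_comap, map_ofNat] at h2Z
      exact h2Z
    have hle : v.asIdeal ≤ P.under (𝓞 k) := by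
      rw [hv, Ideal.span_singleton_le_iff_mem]; exact h2
    exact (v.isMaximal.eq_of_le (Ideal.IsPrime.under (𝓞 k) P).ne_top hle)
  haveI : Algebra.IsUnramifiedAt (𝓞 k) P :=
    (Algebra.isUnramifiedIn_iff_forall_of_isDedekindDomain.mp hunr) P hP hPv
  exact Algebra.IsUnramifiedAt.comp (R := ℤ) (A := 𝓞 k) v.asIdeal P

/-- **`L/k` is ramified at the inert prime `(2)` of `k`** when `L` contains a root `θ` of a cubic
`X³ + AX² + BX + 16c`, `4 ∣ A`, `16 ∣ B`, `c` odd, and `2 ∤ d_k` (the `2`-division field of a curve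
supersingular at `2` over `k = ℚ(√Δ)`, `Δ ≡ 5 mod 8`). [cite: Cohen1993, §6.2.1 Cor. 6.2.4, p. 316] -/
theorem not_isUnramifiedIn_of_root (v : HeightOneSpectrum (𝓞 k))
    (hv : v.asIdeal = Ideal.span {(2 : 𝓞 k)}) (hdk : ¬ (2 : ℤ) ∣ discr k)
    (θ : 𝓞 L) {A B c : ℤ} (hA : 4 ∣ A) (hB : 16 ∣ B) (hc : Odd c)
    (hθ : θ ^ 3 + (A : 𝓞 L) * θ ^ 2 + (B : 𝓞 L) * θ + 16 * (c : 𝓞 L) = 0) :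
    ¬ Algebra.IsUnramifiedIn (𝓞 L) v.asIdeal := fun hunr =>
  not_isUnramifiedIn_two_of_root θ hA hB hc hθ (isUnramifiedIn_int_two_of_isUnramifiedIn v hv hdk hunr)

end OverBase

end Summit.BirchSwinnertonDyer.BirchSwinnertonDyer.Theorems.HeckeThetaPartner

end
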